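import Summits.BirchSwinnertonDyer.BirchSwinnertonDyer.Theses.RamifiedHeegnerPair
import Summits.BirchSwinnertonDyer.BirchSwinnertonDyer.Theorems.RamifiedHeegnerPairGss2LowerAtThreeRankOneMcCallumRoad
import Summits.BirchSwinnertonDyer.BirchSwinnertonDyer.Theorems.RamifiedHeegnerPairGss2LowerAtThreeRankOneNonTowerOfNonSurjThree
import Summits.BirchSwinnertonDyer.BirchSwinnertonDyer.Theorems.RamifiedHeegnerPairGss2LowerAtThreeRankOneIrreducibleRoad
import Summits.BirchSwinnertonDyer.BirchSwinnertonDyer.Theorems.RamifiedHeegnerPairLeafRankOneUpperAtThreeLeafTwistStable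
import Summits.BirchSwinnertonDyer.BirchSwinnertonDyer.Theorems.RamifiedHeegnerPairLeafRankZeroUpperAtThreeOfNonSurjThree
import Summits.BirchSwinnertonDyer.BirchSwinnertonDyer.Theorems.RamifiedHeegnerPairLeafRankOneUpperAtThreeGlueOfLowerRankZero
import Literature.NumberTheory.EllipticCurves.MatarNekovar2019.ShaStructureIrreducible
import HarnessLib

/-!
# Route `RamifiedHeegnerPair` (leaf `WAllExclAddGssAtThree`, W-ALL row 2·3@3) — the COLUMN ASSEMBLY modulo the pair statements:
# the Gss2 leaf closes from PRINT ∧ T1⁻ on the rank-one frames (A 27200, A₃ₙₙ) ∧ the T1⁺ readings (S2 27492, Σ★″ 27493) ∧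
# the two separation inputs S₊|3Nn (U₀ on the `3Nn` rank-0 rows) and S₋ (taken as L₀ 26023)

HONEST FRAMING. Theorems only; helper file (`--supports stmt-BirchSwinnertonDyer-26021 --as helper`); nothing is booked, no item is closed,
BSD is not proved for any curve; EVERY hypothesis below is OPEN except where marked print (and the print ones are un-discharged named facts).
Lead prover bsd-line-rhp-p1 g6, 2026-08-28. Companion of memo `Cruxes/Gss2LowerAtThreeRankOne/COUPLING-CALCULUS-rhp-p1-g6.md`.

WHY THIS FILE. The route's deciding theorem `closes` binds the four member halves L₁ 26021, U₁ 26022, L₀ 26023, U₀ 26024 (+ GZK). The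
lineage's roads reduce them: L₁ ⟸ PUB 27199 ∧ A 27200 ∧ STRUCT ∧ A₃ₙₙ ∧ U₀|3Nn (skeleton v5 of 26021, §1 below = its composition as a
Theorems-side theorem); U₁ ⟸ PUB⁺ 27491 ∧ S2 27492 ∧ Σ★″ 27493 ∧ L₀ (rhp-p2, glue 27494 closer `leafRankOneUpperAtThreeGlue_of_lowerRankZero`);
U₀ ⟸ Kato A161″ ∧ GZK ∧ modularity ∧ U₀|3Nn (`leafRankZeroUpperAtThree_of_katoTam_of_nonSurjThree`); L₀ has only the U₁-conditional Heegner
road (`…RankZeroCertificateRoadByName`) — circular with U₁'s — or Kato-⊇ (announced). §2 composes them into ONE statement of what the column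
costs today: `WAllExclAddGssAtThree ⟸ GZK ∧ PUB 27199 ∧ PUB⁺ 27491 ∧ STRUCT (print) ∧ A 27200 ∧ A₃ₙₙ (T1⁻, research) ∧ S2 27492 ∧ Σ★″ 27493
(T1⁺ readings, research) ∧ U₀|3Nn (S₊ off the tower, residual) ∧ L₀ 26023 (S₋, residual)`. Nothing is double-counted: L₀ enters ONCE (as
itself and as U₁'s separation input), U₀ enters only through its `3Nn` rows.

* §1 `gss2LowerAtThreeRankOne_of_pub_of_certificatesTower_of_structIrr_of_certificates3Nn_of_upper3Nn` — the v5 composition of 26021's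
  registered line `kolyvagin_split` (Cruxes/Gss2LowerAtThreeRankOne/Lines/kolyvagin_split.lean, sha16 1b457893ad53e5c0) as a theorem with the
  five stub texts as hypotheses (so that the skeleton's closing file, when the stubs land, is `exact` this).
* §2 `wAllExclAddGssAtThree_of_print_of_pairStatements_of_upper3Nn_of_lowerRankZero` — the column assembly.

References: [cite: MatarNekovar2019, Thm. 0.7 (p. 456) and §0.11 (p. 457)] [cite: McCallumLMS1991, §5 Cor. 5.6 (p. 310)]
[cite: Kato2004Asterisque, Thm. 14.5 (3) (p. 236), Prop. 14.16 (2) (p. 244)] [cite: Jetchev2008, Thm. 1.4, Conj. 1.3]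
[cite: JetchevSkinnerWan2017, §7.4.1] [cite: Miller2011LMS, Def. 1.1] [cite: GrossZagier1986, Thm. I.(6.3)] [cite: Kolyvagin1990, Thm. A].
-/

-- D-0017: single-problem summit, so `Summit.BirchSwinnertonDyer.BirchSwinnertonDyer.…` repeats a namespace BY DESIGN.
set_option linter.dupNamespace false
set_option autoImplicit false

noncomputable section

open scoped Classical NumberField

open WeierstrassCurve Literature.NumberTheory.EllipticCurves
  Literature.NumberTheory.EllipticCurves.Rank1Residual
  Literature.NumberTheory.EllipticCurves.Rank1Residual.Typed
  Summit.BirchSwinnertonDyer.Rank1Residual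
  Summit.BirchSwinnertonDyer.Rank1Residual.Additive
  Summit.BirchSwinnertonDyer.BirchSwinnertonDyer.Theorems
  Summit.BirchSwinnertonDyer.BirchSwinnertonDyer.Theses.RamifiedHeegnerPair

namespace Summit.BirchSwinnertonDyer.BirchSwinnertonDyer.Theorems.RamifiedPairLowerBound

/-! ## §1 The v5 composition of the L₁ line as a theorem -/

/-- **L₁ 26021 BY NAME ⟸ PUB 27199 ∧ A 27200 ∧ STRUCT ∧ A₃ₙₙ ∧ U₀|3Nn** — the composition `KolyvaginSplit.Gss2LowerAtThreeRankOne_of` of the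
registered skeleton v5 (1b457893ad53e5c0) with the five stub texts as hypotheses: split on `ρ̄_{E,3}` onto; onto ⟹ tower
(`towerSurj_three_of_subGss_of_surj`) ⟹ p618012 §12 with A and Kato A161″ for the twist; not onto ⟹ A₃ₙₙ's odd frame + certificate, the twist
is a `3Nn` leaf curve of analytic rank `0` (`leaf_twist_of_heegner`; a twist of a `3Nn` curve is `3Nn`), U₀|3Nn gives its upper half, p624620
§8 gives L₁. [cite: MatarNekovar2019, Thm. 0.7 (p. 456) and §0.11 (p. 457)] [cite: McCallumLMS1991, §5 Cor. 5.6 (p. 310)]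
[cite: Kato2004Asterisque, Thm. 14.5 (3) (p. 236)] [cite: SilvermanAEC2009, X.5 Cor. 5.4] -/
theorem gss2LowerAtThreeRankOne_of_pub_of_certificatesTower_of_structIrr_of_certificates3Nn_of_upper3Nn
    (hpub : Gss2LowerPrintedInputsAtThree) (hC : Gss2RankOneMcCallumCertificateAtThreeTower)
    (hMN : MatarNekovar2019.thm07_pow_dvd_card_sha_primary_of_certificate_of_irreducible)
    (hC3 : ∀ (W : WeierstrassCurve ℚ) [W.IsElliptic] [W.IsGloballyMinimal], ¬ W.HasCM →
      Literature.NumberTheory.EllipticCurves.Rank1Residual.Addv W 3 → Summit.BirchSwinnertonDyer.Rank1Residual.Additive.SubGss W 3 →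
      W.analyticRank = 1 → ¬ W.HasSurjectiveModNGaloisRep 3 →
      ∃ (N : ℕ) (_ : NeZero N) (K : Type) (_ : Field K) (_ : NumberField K)
        (Dt : Literature.NumberTheory.EllipticCurves.ModularForms.ModularParametrizationData W N)
        (H : Literature.NumberTheory.EllipticCurves.HeegnerDatum N (NumberField.discr K)) (ι : K →+* ℂ)
        (P : (W.baseChange K).toAffine.Point) (Wd : WeierstrassCurve ℚ) (_ : Wd.IsElliptic) (_ : Wd.IsGloballyMinimal)
        (Cd : WeierstrassCurve.VariableChange ℚ) (M : ℕ),
        W.conductorNorm ℤ = N ∧ Literature.NumberTheory.EllipticCurves.IsImaginaryQuadratic K ∧ Odd (NumberField.discr K) ∧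
        Literature.NumberTheory.EllipticCurves.SatisfiesHeegnerHypothesis N K ∧
        (W.quadraticTwist (NumberField.discr K : ℚ)).entireLFunction 1 ≠ 0 ∧
        WeierstrassCurve.Affine.Point.map ι.toRatAlgHom P = Literature.NumberTheory.EllipticCurves.ModularForms.heegnerPointComplex Dt H ∧
        Cd • W.quadraticTwist (NumberField.discr K : ℚ) = Wd ∧
        (2 * M : ℤ) ≤ padicValNat 3 W.tamagawaProduct + padicValNat 3 Wd.tamagawaProduct + 2 * padicValRat 3 (Dt.c : ℚ) ∧
        Summit.BirchSwinnertonDyer.Rank1Residual.X11b.Three.Koly.CertificateAt Dt H.β ι 3 M)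
    (hU0 : ∀ (W : WeierstrassCurve ℚ) [W.IsElliptic] [W.IsGloballyMinimal], ¬ W.HasCM →
      Literature.NumberTheory.EllipticCurves.Rank1Residual.Addv W 3 → Summit.BirchSwinnertonDyer.Rank1Residual.Additive.SubGss W 3 →
      W.analyticRank = 0 → ¬ W.HasSurjectiveModNGaloisRep 3 →
      Literature.NumberTheory.EllipticCurves.Rank1Residual.Typed.MissingUpperBoundAt W 3) :
    Gss2LowerAtThreeRankOne := by
  -- transcript of `KolyvaginSplit.Gss2LowerAtThreeRankOne_of` (skeleton v5)
  obtain ⟨⟨hGZ, hKo, -, hGZK, hmod, -, -, hrec, hMc, h36⟩, hKatoT⟩ := hpub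
  intro W _ _ hCM hadd hsub hr
  haveI : Fact (Nat.Prime 3) := ⟨Nat.prime_three⟩
  by_cases hs : W.HasSurjectiveModNGaloisRep 3
  · exact gssLowerAtThree_rankOne_towerRows_of_exists_mccallumCertificate hGZ hKo hKatoT hGZK hmod hrec h36 hMc hC W hadd hsub hr
      (towerSurj_three_of_subGss_of_surj W hadd hsub hs)
  · obtain ⟨N, hN0, K, _, _, Dt, H, ι, P, Wd, _, _, Cd, M, hN, hK, hodd, hHN, hLt, hP, hWd, hM, hcert⟩ := hC3 W hCM hadd hsub hr hs
    haveI : NeZero N := hN0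
    subst hN
    obtain ⟨hCMd, haddd, hsubd, -⟩ := RamifiedPairUpperBound.leaf_twist_of_heegner W hCM hadd hsub K hK hHN hodd Wd Cd hWd
    have hD0 : (NumberField.discr K : ℚ) ≠ 0 := by exact_mod_cast NumberField.discr_ne_zero K
    haveI hEt : (W.quadraticTwist (NumberField.discr K : ℚ)).IsElliptic := W.isElliptic_quadraticTwist hD0
    have hLt' : (W.quadraticTwist (NumberField.discr K : ℚ)).entireLFunction = Wd.entireLFunction := by
      rw [← hWd, WeierstrassCurve.entireLFunction_smul]
    have hLd1 : Wd.entireLFunction 1 ≠ 0 := by rw [← hLt']; exact hLt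
    have hrd : Wd.analyticRank = 0 := (Wd.analyticRank_eq_zero_iff_holds (hmod Wd)).2 hLd1
    -- a quadratic twist of a `3Nn` curve is `3Nn`
    have hsd : ¬ Wd.HasSurjectiveModNGaloisRep 3 := by
      intro hsd
      obtain ⟨C', hC'⟩ := Summit.BirchSwinnertonDyer.Rank1Residual.Additive.exists_variableChange_quadraticTwist_symm Wd W hD0 ⟨Cd, hWd⟩
      have h := twistAdmissible_hasSurjectiveModNGaloisRep_smul_quadraticTwist Wd hD0 C' 3 hsd
      rw [hC'] at h
      exact hs h
    have hUd : MissingUpperBoundAt Wd 3 := hU0 Wd hCMd haddd hsubd hrd hsd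
    exact missingLowerBoundAt_three_rankOne_gss_of_structIrrCertificate_of_upperTwist W K Dt H ι P (hGZ _ W K) (hKo _ W K) hGZK hmod
      (hrec _ W K) (h36 _ W K) hMN hCM hadd hsub hr hK hHN hP hLt Wd Cd hWd hUd hcert hM

/-! ## §2 The column assembly -/

/-- **THE Gss2 COLUMN MODULO THE PAIR STATEMENTS.** `WAllExclAddGssAtThree` (BSD₃ for every non-CM Gss2-at-3 curve of analytic rank ≤ 1)
follows from: PRINT — GZK (19921), PUB 27199, PUB⁺ 27491, the Matar–Nekovář structure fact; T1⁻ on the rank-one frames — A 27200 (tower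
rows), A₃ₙₙ (`3Nn` rows); the T1⁺ readings — S2 27492 (Jetchev Thm 1.4 divisibility reading), Σ★″ 27493; and the TWO SEPARATION INPUTS —
S₊ off the tower = U₀ on the `3Nn` rank-zero rows, S₋ = L₀ 26023 (which also serves as U₁'s separation input through glue 27494's closer).
Chain: §1 ⟹ L₁; rhp-p2's `leafRankOneUpperAtThreeGlue_of_lowerRankZero hL0` ⟹ U₁ from (PUB⁺, S2, Σ★″);
`leafRankZeroUpperAtThree_of_katoTam_of_nonSurjThree` ⟹ U₀ from (A161″ ∈ PUB, GZK, modularity, U₀|3Nn); the route's `closes`. Every research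
hypothesis is OPEN; this theorem books nothing — it states what the column costs. [cite: Miller2011LMS, Def. 1.1]
[cite: MatarNekovar2019, Thm. 0.7 (p. 456) and §0.11 (p. 457)] [cite: Kato2004Asterisque, Thm. 14.5 (3) (p. 236)] [cite: Jetchev2008, Thm. 1.4] -/
theorem wAllExclAddGssAtThree_of_print_of_pairStatements_of_upper3Nn_of_lowerRankZero
    (hP : PublishedInputGZK) (hpub : Gss2LowerPrintedInputsAtThree) (hpubU : LeafRankOnePrintedInputsAtThree)
    (hMN : MatarNekovar2019.thm07_pow_dvd_card_sha_primary_of_certificate_of_irreducible)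
    (hC : Gss2RankOneMcCallumCertificateAtThreeTower)
    (hC3 : ∀ (W : WeierstrassCurve ℚ) [W.IsElliptic] [W.IsGloballyMinimal], ¬ W.HasCM →
      Literature.NumberTheory.EllipticCurves.Rank1Residual.Addv W 3 → Summit.BirchSwinnertonDyer.Rank1Residual.Additive.SubGss W 3 →
      W.analyticRank = 1 → ¬ W.HasSurjectiveModNGaloisRep 3 →
      ∃ (N : ℕ) (_ : NeZero N) (K : Type) (_ : Field K) (_ : NumberField K)
        (Dt : Literature.NumberTheory.EllipticCurves.ModularForms.ModularParametrizationData W N)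
        (H : Literature.NumberTheory.EllipticCurves.HeegnerDatum N (NumberField.discr K)) (ι : K →+* ℂ)
        (P : (W.baseChange K).toAffine.Point) (Wd : WeierstrassCurve ℚ) (_ : Wd.IsElliptic) (_ : Wd.IsGloballyMinimal)
        (Cd : WeierstrassCurve.VariableChange ℚ) (M : ℕ),
        W.conductorNorm ℤ = N ∧ Literature.NumberTheory.EllipticCurves.IsImaginaryQuadratic K ∧ Odd (NumberField.discr K) ∧
        Literature.NumberTheory.EllipticCurves.SatisfiesHeegnerHypothesis N K ∧
        (W.quadraticTwist (NumberField.discr K : ℚ)).entireLFunction 1 ≠ 0 ∧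
        WeierstrassCurve.Affine.Point.map ι.toRatAlgHom P = Literature.NumberTheory.EllipticCurves.ModularForms.heegnerPointComplex Dt H ∧
        Cd • W.quadraticTwist (NumberField.discr K : ℚ) = Wd ∧
        (2 * M : ℤ) ≤ padicValNat 3 W.tamagawaProduct + padicValNat 3 Wd.tamagawaProduct + 2 * padicValRat 3 (Dt.c : ℚ) ∧
        Summit.BirchSwinnertonDyer.Rank1Residual.X11b.Three.Koly.CertificateAt Dt H.β ι 3 M)
    (hS2 : JetchevDivisibilityReadingS2) (hSig : LeafSigmaStarDivisibilityAtThreeOptimalOffRows)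
    (hU03 : ∀ (W : WeierstrassCurve ℚ) [W.IsElliptic] [W.IsGloballyMinimal], ¬ W.HasCM →
      Literature.NumberTheory.EllipticCurves.Rank1Residual.Addv W 3 → Summit.BirchSwinnertonDyer.Rank1Residual.Additive.SubGss W 3 →
      W.analyticRank = 0 → ¬ W.HasSurjectiveModNGaloisRep 3 →
      Literature.NumberTheory.EllipticCurves.Rank1Residual.Typed.MissingUpperBoundAt W 3)
    (hL0 : Gss2LowerAtThreeRankZero) :
    Summit.BirchSwinnertonDyer.WAllExclAddGssAtThree := by
  have hL1 : Gss2LowerAtThreeRankOne :=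
    gss2LowerAtThreeRankOne_of_pub_of_certificatesTower_of_structIrr_of_certificates3Nn_of_upper3Nn hpub hC hMN hC3 hU03
  have hU1 : LeafRankOneUpperAtThree := RamifiedPairUpperBound.leafRankOneUpperAtThreeGlue_of_lowerRankZero hL0 hpubU hS2 hSig
  have hU0 : LeafRankZeroUpperAtThree :=
    RamifiedPairUpperBound.leafRankZeroUpperAtThree_of_katoTam_of_nonSurjThree hpub.2 hpub.1.2.2.2.1 hpub.1.2.2.2.2.1 hU03
  exact closes hP hL1 hU1 hL0 hU0

end Summit.BirchSwinnertonDyer.BirchSwinnertonDyer.Theorems.RamifiedPairLowerBound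

end
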